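import Summits.AtomisticToContinuum.HydrodynamicLimit.Theorems.JaynesSqueezeBlockGibbsCorners
import Literature.Analysis.FunctionSpaces.TorusGridCellsGeometry
import Literature.Analysis.FluidPDE.HardSpherePhaseSpaceProofs
import Literature.MathematicalPhysics.KineticTheory.HardSphereEuler
import HarnessLib

/-!
# Crux `NearConstantShortTimeHL` (stmt-AtomisticToContinuum-12502), line `small-tilt-domination` — chessboard geometry of `𝕋³`

Support file for the crux `…Theses.RelayRaceLocality.NearConstantShortTimeHL`, line
`small-tilt-domination`, registered stubs `torus_cells_partition`, `torus_cells_separation`,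
`torus_cells_locality` (the torus-cell geometry behind the chessboard estimate `stub_velocityLD`).

The flat torus `𝕋³ = UnitAddTorus (Fin 3)` is cut into the `k³` half-open cells
`cell j = {y | gridIndex k (repr y) = finIndex j}`, `j : Fin 3 → Fin k`, of side `1/k`, through the
fundamental-cube representative `repr : 𝕋³ → [0,1)³` (`gridIndex k x = (⌊k xᵢ⌋)ᵢ`).

* `torus_cells_partition` — the cells form a measurable partition of `𝕋³` into sets of Haar volume
  `k⁻³` (pull back the tiling of `[0,1)³` by the grid cells `Q_k(j)` along the measure-preserving
  section `repr`), and lower Lebesgue integrals split along it.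
* `torus_cells_separation` — for `k` even, two points in distinct cells whose indices have the same
  parity vector are at minimal-image distance `> 1/k`: in a coordinate `i` with `jᵢ ≠ j'ᵢ` one has
  `2 ≤ |jᵢ - j'ᵢ| ≤ k - 2`, so `t = repr y i - repr y' i` satisfies `1/k < |t - n|` for every integer
  `n`, whence `‖(y - y') i‖ = |t - round t| > 1/k`.
* `torus_cells_locality` — a minimal-image ball of radius `ℓ ≤ 1/(2k)` meets at most `27` cells:
  each coordinate of the index of a cell meeting the ball is congruent mod `k` to one of
  `cᵢ - 1, cᵢ, cᵢ + 1`, `c = gridIndex k (repr z)` the index of the centre.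

References: folklore (elementary geometry of the cubic grid on the flat torus).
-/

noncomputable section

namespace Summit.AtomisticToContinuum.HydrodynamicLimit.Theorems.NearConstantShortTimeHL

open scoped BigOperators ENNReal
open MeasureTheory Set
open Literature.MathematicalPhysics.KineticTheory Literature.Analysis.FluidPDE Literature.Analysis.FunctionSpaces

/-! ## Coordinates of torus points through the fundamental-cube representative -/

/-- The coordinate circle-norms of `y - z` through representatives:
`‖(y - z) i‖ = |t - round t|` with `t = repr y i - repr z i` (a coordinate of a point of `𝕋³` is
the class of the corresponding coordinate of its representative, `BlockGibbsLine.apply_eq_coe_repr`).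
Each of them is at most the minimal-image distance `euclidDist y z` (`norm_le_pi_norm` and
`Torus.norm_sub_le_euclidDist_holds`, used inline below). [folklore] -/
theorem norm_sub_apply_eq_abs (y z : T3) (i : Fin 3) :
    ‖(y - z) i‖ =
      |Torus.repr y i - Torus.repr z i - round (Torus.repr y i - Torus.repr z i)| := by
  rw [Pi.sub_apply, BlockGibbsLine.apply_eq_coe_repr y i, BlockGibbsLine.apply_eq_coe_repr z i,
    ← AddCircle.coe_sub, UnitAddCircle.norm_eq]

/-- Cell membership, coordinatewise and without divisions: if `gridIndex k (repr y) = finIndex j`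
then `jᵢ ≤ k · repr y i < jᵢ + 1`. [folklore] -/
theorem cell_coord {k : ℕ} {y : T3} {j : Fin 3 → Fin k}
    (hy : Torus.gridIndex k (Torus.repr y) = Torus.finIndex j) (i : Fin 3) :
    ((j i : ℕ) : ℝ) ≤ (k : ℝ) * Torus.repr y i ∧ (k : ℝ) * Torus.repr y i < ((j i : ℕ) : ℝ) + 1 := by
  have h := congrFun hy i
  rw [Torus.gridIndex_apply, Torus.finIndex_apply, Int.floor_eq_iff] at h
  exact_mod_cast h

/-! ## The cells are a measurable partition of `𝕋³` into sets of volume `k⁻³` -/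

/-- The cell of index `j` is the preimage under `repr` of the grid cell `Q_k(j)` of `ℝ³`.
[folklore] -/
theorem cell_eq_preimage {k : ℕ} (hk : 0 < k) (j : Fin 3 → Fin k) :
    {y : T3 | Torus.gridIndex k (Torus.repr y) = Torus.finIndex j} =
      Torus.repr ⁻¹' {x : EuclideanSpace ℝ (Fin 3) |
        (k : ℝ) • x - Torus.latticeVec (Torus.finIndex j) ∈ Torus.unitCube (Fin 3)} := by
  ext y
  simp only [mem_setOf_eq, mem_preimage, Torus.mem_gridCell_iff_gridIndex_eq hk]

/-- The cells are measurable. [folklore] -/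
theorem measurableSet_cell {k : ℕ} (hk : 0 < k) (j : Fin 3 → Fin k) :
    MeasurableSet {y : T3 | Torus.gridIndex k (Torus.repr y) = Torus.finIndex j} := by
  rw [cell_eq_preimage hk]
  exact (Torus.measurableSet_gridCell k _).preimage Torus.measurable_repr

/-- Each cell has Haar volume `k⁻³` (`repr` is measure preserving onto the unit cube, and the
grid cell `Q_k(j) ⊆ [0,1)³` has Lebesgue measure `k⁻³`). [folklore] -/
theorem volume_cell {k : ℕ} (hk : 0 < k) (j : Fin 3 → Fin k) :
    volume {y : T3 | Torus.gridIndex k (Torus.repr y) = Torus.finIndex j} = ((k : ℝ≥0∞)⁻¹) ^ 3 := by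
  rw [cell_eq_preimage hk, (Torus.measurePreserving_repr (d := Fin 3)).measure_preimage
      (Torus.measurableSet_gridCell k _).nullMeasurableSet,
    Measure.restrict_apply (Torus.measurableSet_gridCell k _),
    inter_eq_left.2 (Torus.gridCell_subset_unitCube hk j), Torus.volume_gridCell hk,
    Fintype.card_fin]

/-- Every point of `𝕋³` lies in exactly one cell (its representative lies in `[0,1)³`, which the
grid cells `Q_k(j)`, `j : Fin 3 → Fin k`, tile). [folklore] -/
theorem existsUnique_cell {k : ℕ} (hk : 0 < k) (y : T3) :
    ∃! j : Fin 3 → Fin k, Torus.gridIndex k (Torus.repr y) = Torus.finIndex j := by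
  have hmem : Torus.repr y ∈ ⋃ j : Fin 3 → Fin k, {x : EuclideanSpace ℝ (Fin 3) |
      (k : ℝ) • x - Torus.latticeVec (Torus.finIndex j) ∈ Torus.unitCube (Fin 3)} := by
    rw [Torus.iUnion_gridCell_eq_unitCube hk]
    exact Torus.repr_mem_unitCube y
  obtain ⟨j, hj⟩ := mem_iUnion.1 hmem
  have hj' : Torus.gridIndex k (Torus.repr y) = Torus.finIndex j :=
    (Torus.mem_gridCell_iff_gridIndex_eq hk).1 hj
  exact ⟨j, hj', fun j' hj'' => Torus.finIndex_injective (hj''.symm.trans hj')⟩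

/-- The cells cover `𝕋³`. [folklore] -/
theorem iUnion_cell_eq_univ {k : ℕ} (hk : 0 < k) :
    (⋃ j : Fin 3 → Fin k, {y : T3 | Torus.gridIndex k (Torus.repr y) = Torus.finIndex j}) = univ := by
  refine eq_univ_of_forall fun y => ?_
  obtain ⟨j, hj, -⟩ := existsUnique_cell hk y
  exact mem_iUnion.2 ⟨j, hj⟩

/-- The cells are pairwise disjoint. [folklore] -/
theorem pairwise_disjoint_cell {k : ℕ} :
    Pairwise (Function.onFun Disjoint fun j : Fin 3 → Fin k =>
      {y : T3 | Torus.gridIndex k (Torus.repr y) = Torus.finIndex j}) := by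
  intro j j' hjj'
  simp only [Function.onFun, disjoint_left, mem_setOf_eq]
  intro y hy hy'
  exact hjj' (Torus.finIndex_injective (hy.symm.trans hy'))

/-- Lower Lebesgue integrals over `𝕋³` split along the cells. [folklore] -/
theorem lintegral_eq_sum_cell {k : ℕ} (hk : 0 < k) (f : T3 → ℝ≥0∞) :
    ∫⁻ y, f y = ∑ j : Fin 3 → Fin k,
      ∫⁻ y in {y : T3 | Torus.gridIndex k (Torus.repr y) = Torus.finIndex j}, f y := by
  have h := lintegral_iUnion (μ := volume) (fun j => measurableSet_cell hk j)
    (pairwise_disjoint_cell (k := k)) f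
  rw [iUnion_cell_eq_univ hk, setLIntegral_univ, tsum_fintype] at h
  exact h

/-- **The cells of mesh `1/k` are a measurable partition of `𝕋³` into `k³` sets of Haar volume
`k⁻³`, along which lower Lebesgue integrals split.** Registered stub `torus_cells_partition` of the
line `small-tilt-domination`. [folklore] -/
theorem torus_cells_partition : ∀ k : ℕ, 0 < k → (∀ y : T3, ∃! j : Fin 3 → Fin k, Torus.gridIndex k (Torus.repr y) = Torus.finIndex j) ∧ (∀ j : Fin 3 → Fin k, MeasurableSet {y : T3 | Torus.gridIndex k (Torus.repr y) = Torus.finIndex j} ∧ volume {y : T3 | Torus.gridIndex k (Torus.repr y) = Torus.finIndex j} = ((k : ℝ≥0∞)⁻¹) ^ 3) ∧ (∀ f : T3 → ℝ≥0∞, ∫⁻ y, f y = ∑ j : Fin 3 → Fin k, ∫⁻ y in {y : T3 | Torus.gridIndex k (Torus.repr y) = Torus.finIndex j}, f y) :=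
  fun _k hk => ⟨existsUnique_cell hk, fun j => ⟨measurableSet_cell hk j, volume_cell hk j⟩,
    lintegral_eq_sum_cell hk⟩

/-! ## Same-colour cells are `1/k`-separated -/

/-- One-dimensional separation estimate: if `D - 1 < S < D + 1` for an integer `D` with
`2 ≤ |D| ≤ k - 2`, then `S` is at distance `> 1` from every integer multiple of `k`. [folklore] -/
theorem one_lt_abs_sub_mul {k : ℕ} {D n : ℤ}
    (hD : (2 ≤ D ∧ D + 2 ≤ (k : ℤ)) ∨ (D ≤ -2 ∧ 2 - D ≤ (k : ℤ)))
    {S : ℝ} (h1 : (D : ℝ) - 1 < S) (h2 : S < (D : ℝ) + 1) : 1 < |S - (k : ℝ) * n| := by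
  have hk0 : (0 : ℝ) ≤ k := Nat.cast_nonneg _
  rcases hD with ⟨hD1, hD2⟩ | ⟨hD1, hD2⟩
  · have hD1' : (2 : ℝ) ≤ D := by exact_mod_cast hD1
    have hD2' : (D : ℝ) + 2 ≤ k := by exact_mod_cast hD2
    rcases le_or_gt n 0 with hn | hn
    · have hn' : (n : ℝ) ≤ 0 := by exact_mod_cast hn
      have hkn : (k : ℝ) * n ≤ 0 := mul_nonpos_iff.2 (Or.inl ⟨hk0, hn'⟩)
      exact lt_abs.2 (Or.inl (by linarith))
    · have hn' : (1 : ℝ) ≤ n := by exact_mod_cast hn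
      have hkn : (k : ℝ) ≤ k * n := le_mul_of_one_le_right hk0 hn'
      exact lt_abs.2 (Or.inr (by linarith))
  · have hD1' : (D : ℝ) ≤ -2 := by exact_mod_cast hD1
    have hD2' : 2 - (D : ℝ) ≤ k := by exact_mod_cast hD2
    rcases lt_or_ge n 0 with hn | hn
    · have hn' : (n : ℝ) ≤ -1 := by exact_mod_cast Int.le_sub_one_of_lt hn
      have hkn : (k : ℝ) * n ≤ -k := by
        have := mul_le_mul_of_nonneg_left hn' hk0
        linarith
      exact lt_abs.2 (Or.inl (by linarith))
    · have hn' : (0 : ℝ) ≤ n := by exact_mod_cast hn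
      have hkn : 0 ≤ (k : ℝ) * n := mul_nonneg hk0 hn'
      exact lt_abs.2 (Or.inr (by linarith))

/-- **Distinct cells of the same colour are `1/k`-separated.** For `k` even, if `j ≠ j'` have the
same parity vector, any two points `y ∈ cell j`, `y' ∈ cell j'` are at minimal-image distance
`> 1/k`. Registered stub `torus_cells_separation` of the line `small-tilt-domination`. [folklore] -/
theorem torus_cells_separation : ∀ k : ℕ, 0 < k → Even k → ∀ j j' : Fin 3 → Fin k, j ≠ j' → (∀ i, (j i : ℕ) % 2 = (j' i : ℕ) % 2) → ∀ y y' : T3, Torus.gridIndex k (Torus.repr y) = Torus.finIndex j → Torus.gridIndex k (Torus.repr y') = Torus.finIndex j' → (k : ℝ)⁻¹ < Torus.euclidDist y y' := by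
  intro k hk hke j j' hjj' hpar y y' hy hy'
  -- a coordinate in which the two indices differ
  obtain ⟨i, hi⟩ : ∃ i, j i ≠ j' i := Function.ne_iff.1 hjj'
  have hyi := cell_coord hy i
  have hy'i := cell_coord hy' i
  obtain ⟨r, hr⟩ := hke
  have hD : (2 ≤ ((j i : ℕ) : ℤ) - ((j' i : ℕ) : ℤ) ∧ ((j i : ℕ) : ℤ) - ((j' i : ℕ) : ℤ) + 2 ≤ (k : ℤ)) ∨
      (((j i : ℕ) : ℤ) - ((j' i : ℕ) : ℤ) ≤ -2 ∧ 2 - (((j i : ℕ) : ℤ) - ((j' i : ℕ) : ℤ)) ≤ (k : ℤ)) := by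
    have h1 := (j i).isLt
    have h2 := (j' i).isLt
    have h3 := hpar i
    have h4 : (j i : ℕ) ≠ (j' i : ℕ) := fun h => hi (Fin.ext h)
    omega
  have hk' : (0 : ℝ) < k := by exact_mod_cast hk
  refine lt_of_lt_of_le ?_
    ((norm_le_pi_norm (y - y') i).trans (Torus.norm_sub_le_euclidDist_holds y y'))
  rw [norm_sub_apply_eq_abs]
  have key := one_lt_abs_sub_mul (n := round (Torus.repr y i - Torus.repr y' i)) hD
    (S := (k : ℝ) * (Torus.repr y i - Torus.repr y' i))
    (by push_cast; rw [mul_sub]; linarith [hyi.1, hy'i.2])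
    (by push_cast; rw [mul_sub]; linarith [hyi.2, hy'i.1])
  rw [← mul_sub, abs_mul, abs_of_pos hk'] at key
  refine lt_of_mul_lt_mul_left ?_ hk'.le
  rwa [mul_inv_cancel₀ hk'.ne']

/-! ## A ball of radius `≤ 1/(2k)` meets at most `27` cells -/

/-- One-dimensional locality estimate: if `jᵢ ≤ k a < jᵢ + 1`, `c ≤ k b < c + 1` and
`|k (a - b - m)| < 1/2`, then `jᵢ = c + s + k m` with `s ∈ {-1, 0, 1}`. [folklore] -/
theorem exists_shift_of_abs_lt {k : ℕ} {J c m : ℤ} {A B : ℝ}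
    (hJ : (J : ℝ) ≤ A ∧ A < (J : ℝ) + 1) (hc : (c : ℝ) ≤ B ∧ B < (c : ℝ) + 1)
    (hm : |A - B - (k : ℝ) * m| < 1 / 2) :
    J - c - (k : ℤ) * m ∈ ({-1, 0, 1} : Finset ℤ) := by
  rw [abs_lt] at hm
  have hlo : (-2 : ℝ) < ((J - c - (k : ℤ) * m : ℤ) : ℝ) := by
    push_cast
    linarith [hJ.2, hc.1, hm.1]
  have hhi : ((J - c - (k : ℤ) * m : ℤ) : ℝ) < 2 := by
    push_cast
    linarith [hJ.1, hc.2, hm.2]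
  have hlo' : (-2 : ℤ) < J - c - (k : ℤ) * m := by exact_mod_cast hlo
  have hhi' : J - c - (k : ℤ) * m < 2 := by exact_mod_cast hhi
  simp only [Finset.mem_insert, Finset.mem_singleton]
  omega

/-- **A minimal-image ball of radius `ℓ ≤ 1/(2k)` meets at most `27` cells.** Registered stub
`torus_cells_locality` of the line `small-tilt-domination`. [folklore] -/
theorem torus_cells_locality : ∀ k : ℕ, 0 < k → ∀ ℓ : ℝ, ℓ ≤ 1 / (2 * k) → ∀ z : T3, ∀ J : Finset (Fin 3 → Fin k), (∀ j ∈ J, ∃ y : T3, Torus.gridIndex k (Torus.repr y) = Torus.finIndex j ∧ Torus.euclidDist y z < ℓ) → J.card ≤ 27 := by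
  intro k hk ℓ hℓ z J hJ
  have hk' : (0 : ℝ) < k := by exact_mod_cast hk
  -- the admissible residues of each coordinate of the index of a cell meeting the ball
  set c : Fin 3 → ℤ := Torus.gridIndex k (Torus.repr z) with hc
  let A : Fin 3 → Finset ℤ := fun i =>
    ({-1, 0, 1} : Finset ℤ).image fun s => (c i + s) % (k : ℤ)
  have hAcard : ∀ i, (A i).card ≤ 3 := fun i => Finset.card_image_le.trans Finset.card_le_three
  have hsub : J.image Torus.finIndex ⊆ Fintype.piFinset A := by
    intro m hm
    obtain ⟨j, hj, rfl⟩ := Finset.mem_image.1 hm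
    rw [Fintype.mem_piFinset]
    intro i
    obtain ⟨y, hy, hdist⟩ := hJ j hj
    have hyi := cell_coord hy i
    have hzi : ((c i : ℤ) : ℝ) ≤ (k : ℝ) * Torus.repr z i ∧ (k : ℝ) * Torus.repr z i < ((c i : ℤ) : ℝ) + 1 :=
      ⟨Int.floor_le _, Int.lt_floor_add_one _⟩
    -- the coordinate `i` of `y - z` is `1/(2k)`-small on the circle
    have hsmall : |Torus.repr y i - Torus.repr z i - round (Torus.repr y i - Torus.repr z i)| <
        1 / (2 * k) := by
      rw [← norm_sub_apply_eq_abs]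
      exact ((norm_le_pi_norm (y - z) i).trans (Torus.norm_sub_le_euclidDist_holds y z)).trans_lt
        (hdist.trans_le hℓ)
    set n : ℤ := round (Torus.repr y i - Torus.repr z i) with hn
    have hsmall' : |(k : ℝ) * Torus.repr y i - (k : ℝ) * Torus.repr z i - (k : ℝ) * n| < 1 / 2 := by
      rw [← mul_sub, ← mul_sub, abs_mul, abs_of_pos hk']
      calc (k : ℝ) * |Torus.repr y i - Torus.repr z i - n|
          < k * (1 / (2 * k)) := mul_lt_mul_of_pos_left hsmall hk'
        _ = 1 / 2 := by field_simp
    have hs := exists_shift_of_abs_lt hyi hzi hsmall'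
    refine Finset.mem_image.2 ⟨((j i : ℕ) : ℤ) - c i - (k : ℤ) * n, hs, ?_⟩
    have h0 : (0 : ℤ) ≤ ((j i : ℕ) : ℤ) := Int.natCast_nonneg _
    have hlt : ((j i : ℕ) : ℤ) < (k : ℤ) := by exact_mod_cast (j i).isLt
    rw [Torus.finIndex_apply, show c i + (((j i : ℕ) : ℤ) - c i - (k : ℤ) * n) =
        ((j i : ℕ) : ℤ) + (k : ℤ) * (-n) by ring, Int.add_mul_emod_self_left,
      Int.emod_eq_of_lt h0 hlt]
  calc J.card = (J.image Torus.finIndex).card :=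
        (Finset.card_image_of_injective J Torus.finIndex_injective).symm
    _ ≤ (Fintype.piFinset A).card := Finset.card_le_card hsub
    _ = ∏ i, (A i).card := Fintype.card_piFinset A
    _ ≤ ∏ _i : Fin 3, 3 := Finset.prod_le_prod (fun i _ => Nat.zero_le _) fun i _ => hAcard i
    _ = 27 := by norm_num [Finset.prod_const, Finset.card_univ]

end Summit.AtomisticToContinuum.HydrodynamicLimit.Theorems.NearConstantShortTimeHL

end
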